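import Mathlib.Analysis.SpecialFunctions.Pow.Deriv
import Mathlib.Analysis.SpecialFunctions.Trigonometric.Deriv
import Mathlib.Analysis.Calculus.BumpFunction.InnerProduct
import Mathlib.Analysis.Calculus.IteratedDeriv.Lemmas
import Mathlib.MeasureTheory.Function.SpecialFunctions.Basic
import Literature.Probability.Percolation.OneArmMaximumPrinciple
import HarnessLib

/-!
# The generator of the radial Bessel process: eigenfunction and supersolution (LSW's `H`)

Topic `Probability/RandomPlanarGeometry`; pure real analysis (definitions and theorems, no named
fact). The radial Bessel process of SLE_κ, `dYₜ = cot(Yₜ/2) dt - √κ dBₜ` on `(0, 2π)` (LSW (2002),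
(2.11); Lawler (2005), (1.16), (6.13)), has generator `L F = (κ/2) F'' + cot(·/2) F'`; LSW's PDE
(2.4) is `L h = ∂ₜ h`, and its separated solutions `e^{μ t} F` solve `Λ_μ F := L F + μ F = 0`.
This file provides the two explicit functions on which the exit estimates of the radial Bessel
process rest, for every `κ > 4` (with `a := 1 - 4/κ`, LSW's `q = (κ-4)/κ`, p. 7):

* `expGenerator κ μ F = (κ/2) F'' + cot(·/2) F' + μ F` (`deriv`, `iteratedDeriv 2`; the tree's
  operator `lswOp` of `OneArmMaximumPrinciple` applied to a function), its
  measurability/continuity on `(0, 2π)`, invariance under modification away from a point, and a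
  **`C²` extension lemma** (`exists_contDiff_eventuallyEq`): a function `C²` on `(0, 2π)` agrees
  near every point of `(δ, 2π - δ)` with a global `C²` function (smooth bump cut-off), so that the
  tree's Itô formula (global `C²` integrands) applies to functions singular at `0`, `2π`;
* **LSW's eigenfunction** `lswEigen κ y = sin(y/4)^a` with
  `Λ_λ (lswEigen κ) = 0` on `(0, 2π)` for **`λ = lswLambda κ = (κ² - 16)/(32κ)`** (the tree's `lswLambda`, `OneArmMaximumPrinciple`)
  (`expGenerator_lswEigen`): this is `Λ H = 0` for `H(θ, t) = sin(θ/4)^q e^{-λt}`, LSW (2002),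
  p. 7 ("Note that `H` also has all these properties"), eq. (1.1); for `κ = 6`, `a = 1/3` and
  `λ = 5/48`, the one-arm exponent;
* **a positive supersolution with a larger rate** (`tailFn`, `tailRate`): for `p = 3a/4`,
  `c₀ = (a - p)/(1 - a + p)` and `μ₀ = (κ p/8)(1 - a + p)`, the function `φ = c₀ + sin(·/2)^p`
  satisfies `Λ_{μ₀} φ ≤ 0` on `(0, 2π)` (`expGenerator_tailFn_nonpos`), `c₀ ≤ φ ≤ c₀ + 1`, and
  `μ₀ > λ` (`lswLambda_lt_tailRate`); it yields exponential tails `P[σ > t] ≤ C e^{-μ₀ t}` of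
  the exit time with a rate beating `λ`, hence `E[e^{λ σ}] < ∞` (cf. Lawler (2005), Lemma 1.28
  and (1.21)–(1.22), where the Dirichlet rate is `(κ - 4)/8 > λ`). Elementary calculus; no claim
  of provenance for `φ`.

## References

* G. F. Lawler, O. Schramm, W. Werner, *One-arm exponent for critical 2D percolation*, Electron.
  J. Probab. 7 (2002), no. 2: (1.1), (2.4), (2.11), p. 7 (`H`, `q`). [LawlerSchrammWernerEJP2002]
* G. F. Lawler, *Conformally Invariant Processes in the Plane*, AMS (2005), §1.11: (1.16),
  Lemma 1.28, Lemma 1.31. [Lawler2005]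
-/

noncomputable section

open Set Filter Topology Metric

namespace Literature.Probability.RandomPlanarGeometry

namespace RadialLoewner

open scoped NNReal
open Literature.Probability.Percolation (lswQ lswLambda lswOp lswQ_pos lswQ_lt_one lswLambda_pos
  sin_quarter_pos cos_quarter_pos)

/-! ### The weighted generator -/

/-- **The generator of the radial Bessel process plus a constant potential**:
`Λ_μ F (y) = (κ/2) F''(y) + cot(y/2) F'(y) + μ F(y)` — the operator of LSW's PDE (2.4)
(`(κ/2) ∂²_θ h + cot(θ/2) ∂_θ h - ∂ₜ h = 0`) on separated solutions `e^{μ t} F(θ)`; Lawler (2005),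
Lemma 1.31 (with `a = 2/κ` and time scaled by `κ`). [cite: LawlerSchrammWernerEJP2002, §2 (2.4)] -/
def expGenerator (κ : ℝ≥0) (μ : ℝ) (F : ℝ → ℝ) (y : ℝ) : ℝ :=
  lswOp κ y (iteratedDeriv 2 F y) (deriv F y) (-(μ * F y))

/-- `Λ_μ F = (κ/2) F'' + cot(·/2) F' + μ F` (the tree's `lswOp` of `OneArmMaximumPrinciple`,
with `∂ₜ (e^{μt} F) = μ e^{μt} F` moved to the other side). [folklore] -/
theorem expGenerator_apply (κ : ℝ≥0) (μ : ℝ) (F : ℝ → ℝ) (y : ℝ) :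
    expGenerator κ μ F y =
      (κ : ℝ) / 2 * iteratedDeriv 2 F y + Real.cot (y / 2) * deriv F y + μ * F y := by
  rw [expGenerator, lswOp]; ring

/-- `Real.cot` is measurable. [folklore] -/
theorem _root_.Real.measurable_cot : Measurable Real.cot := by
  have : Real.cot = fun x ↦ Real.cos x / Real.sin x := funext fun x ↦ Real.cot_eq_cos_div_sin x
  rw [this]
  exact Real.measurable_cos.div Real.measurable_sin

/-- The weighted generator is measurable (for `F ∈ C²`). [folklore] -/
theorem measurable_expGenerator (κ : ℝ≥0) (μ : ℝ) {F : ℝ → ℝ} (hF : ContDiff ℝ 2 F) :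
    Measurable (expGenerator κ μ F) := by
  rw [show expGenerator κ μ F = fun y ↦ (κ : ℝ) / 2 * iteratedDeriv 2 F y +
    Real.cot (y / 2) * deriv F y + μ * F y from funext (expGenerator_apply κ μ F)]
  have h2 : Continuous (iteratedDeriv 2 F) := hF.continuous_iteratedDeriv 2 (by norm_num)
  have h1 : Continuous (deriv F) := hF.continuous_deriv (by norm_num)
  exact ((measurable_const.mul h2.measurable).add
    ((Real.measurable_cot.comp (measurable_id.div_const _)).mul h1.measurable)).add
    (measurable_const.mul hF.continuous.measurable)

/-- `cot (y/2)` is continuous on `(0, 2π)`. [folklore] -/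
theorem continuousOn_cot_half :
    ContinuousOn (fun y : ℝ ↦ Real.cot (y / 2)) (Ioo 0 (2 * Real.pi)) := by
  have : (fun y : ℝ ↦ Real.cot (y / 2)) = fun y ↦ Real.cos (y / 2) / Real.sin (y / 2) :=
    funext fun y ↦ Real.cot_eq_cos_div_sin _
  rw [this]
  refine (Real.continuous_cos.comp (continuous_id.div_const _)).continuousOn.div
    (Real.continuous_sin.comp (continuous_id.div_const _)).continuousOn fun y hy ↦ ?_
  exact (Real.sin_pos_of_pos_of_lt_pi (by linarith [hy.1]) (by linarith [hy.2])).ne'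

/-- The weighted generator of a `C²` function is continuous on `(0, 2π)`. [folklore] -/
theorem continuousOn_expGenerator (κ : ℝ≥0) (μ : ℝ) {F : ℝ → ℝ} (hF : ContDiff ℝ 2 F) :
    ContinuousOn (expGenerator κ μ F) (Ioo 0 (2 * Real.pi)) := by
  rw [show expGenerator κ μ F = fun y ↦ (κ : ℝ) / 2 * iteratedDeriv 2 F y +
    Real.cot (y / 2) * deriv F y + μ * F y from funext (expGenerator_apply κ μ F)]
  have h2 : Continuous (iteratedDeriv 2 F) := hF.continuous_iteratedDeriv 2 (by norm_num)
  have h1 : Continuous (deriv F) := hF.continuous_deriv (by norm_num)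
  exact ((continuous_const.mul h2).continuousOn.add
    (continuousOn_cot_half.mul h1.continuousOn)).add
      (continuous_const.mul hF.continuous).continuousOn

/-- The weighted generator of a `C²` function is bounded on every compact subinterval of
`(0, 2π)`. [folklore] -/
theorem exists_bound_expGenerator (κ : ℝ≥0) (μ : ℝ) {F : ℝ → ℝ} (hF : ContDiff ℝ 2 F) {α β : ℝ}
    (hα : 0 < α) (hβ : β < 2 * Real.pi) :
    ∃ C : ℝ, ∀ y ∈ Icc α β, |expGenerator κ μ F y| ≤ C := by
  have hsub : Icc α β ⊆ Ioo 0 (2 * Real.pi) := fun y hy ↦ ⟨hα.trans_le hy.1, hy.2.trans_lt hβ⟩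
  obtain ⟨C, hC⟩ := isCompact_Icc.exists_bound_of_continuousOn
    ((continuousOn_expGenerator κ μ hF).mono hsub)
  exact ⟨C, fun y hy ↦ by simpa [Real.norm_eq_abs] using hC y hy⟩

/-- **Locality of the generator**: functions agreeing near `y` have the same weighted generator
at `y`. [folklore] -/
theorem expGenerator_congr {κ : ℝ≥0} {μ : ℝ} {F G : ℝ → ℝ} {y : ℝ} (h : F =ᶠ[𝓝 y] G) :
    expGenerator κ μ F y = expGenerator κ μ G y := by
  rw [expGenerator_apply, expGenerator_apply, h.deriv_eq, h.eq_of_nhds,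
    iteratedDeriv_succ, iteratedDeriv_one, iteratedDeriv_succ, iteratedDeriv_one, h.deriv.deriv_eq]

/-! ### Global `C²` extensions off the singular endpoints -/

/-- **`C²` extension lemma**: a function `C²` on `(0, 2π)` agrees, near every point of
`(δ, 2π - δ)` (`0 < δ < π`), with a global `C²` function (cut off by a smooth bump supported in
`[δ/2, 2π - δ/2]` and equal to `1` on `[δ, 2π - δ]`). Used to feed functions singular at `0` and
`2π` (`sin(y/4)^a`) to Itô's formula, which in the tree requires global `C²` integrands. [folklore] -/
theorem exists_contDiff_eventuallyEq {G : ℝ → ℝ} (hG : ContDiffOn ℝ 2 G (Ioo 0 (2 * Real.pi)))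
    {δ : ℝ} (hδ : 0 < δ) (hδ' : δ < Real.pi) :
    ∃ F : ℝ → ℝ, ContDiff ℝ 2 F ∧ ∀ y ∈ Ioo δ (2 * Real.pi - δ), F =ᶠ[𝓝 y] G := by
  let χ : ContDiffBump (Real.pi : ℝ) := ⟨Real.pi - δ, Real.pi - δ / 2, by linarith, by linarith⟩
  refine ⟨fun y ↦ χ y * G y, ?_, ?_⟩
  · refine contDiff_iff_contDiffAt.2 fun y ↦ ?_
    by_cases hy : y ∈ Ioo 0 (2 * Real.pi)
    · exact (χ.contDiff.contDiffAt).mul (hG.contDiffAt (Ioo_mem_nhds hy.1 hy.2))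
    · -- outside `(0, 2π)` the bump vanishes identically near `y`
      have hrOut : χ.rOut = Real.pi - δ / 2 := rfl
      have hy' : y ∉ tsupport χ := by
        rw [χ.tsupport_eq, hrOut]
        intro hmem
        rw [mem_closedBall, Real.dist_eq, abs_le] at hmem
        apply hy
        constructor <;> [linarith [hmem.1]; linarith [hmem.2]]
      have h0 : (χ : ℝ → ℝ) =ᶠ[𝓝 y] 0 := notMem_tsupport_iff_eventuallyEq.1 hy'
      have h1 : (fun y ↦ χ y * G y) =ᶠ[𝓝 y] fun _ ↦ 0 := by
        filter_upwards [h0] with z hz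
        simp [hz]
      exact (contDiffAt_const.congr_of_eventuallyEq h1)
  · intro y hy
    have hrIn : χ.rIn = Real.pi - δ := rfl
    have hball : ball (Real.pi : ℝ) χ.rIn ∈ 𝓝 y := by
      refine isOpen_ball.mem_nhds ?_
      rw [mem_ball, Real.dist_eq, abs_lt, hrIn]
      constructor <;> [linarith [hy.1, hy.2]; linarith [hy.1, hy.2]]
    filter_upwards [hball] with z hz
    rw [χ.one_of_mem_closedBall (ball_subset_closedBall hz), one_mul]

/-! ### Calculus of `y ↦ sin(y/m)^q` -/

section SinPow

variable {m q y : ℝ}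

/-- `d/dy sin(y/m) = cos(y/m)/m`. [folklore] -/
theorem hasDerivAt_sin_div (m y : ℝ) :
    HasDerivAt (fun y : ℝ ↦ Real.sin (y / m)) (Real.cos (y / m) / m) y := by
  have h := ((hasDerivAt_id y).div_const m).sin
  simpa [div_eq_mul_inv, mul_comm] using h

/-- `d/dy cos(y/m) = -sin(y/m)/m`. [folklore] -/
theorem hasDerivAt_cos_div (m y : ℝ) :
    HasDerivAt (fun y : ℝ ↦ Real.cos (y / m)) (-Real.sin (y / m) / m) y := by
  have h := ((hasDerivAt_id y).div_const m).cos
  simpa [div_eq_mul_inv, mul_comm, neg_mul] using h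

/-- **First derivative of `sin(y/m)^q`** where `sin(y/m) > 0`:
`q sin(y/m)^q cos(y/m) / (m sin(y/m))`. [folklore] -/
theorem hasDerivAt_sinPow (hy : 0 < Real.sin (y / m)) :
    HasDerivAt (fun y : ℝ ↦ Real.sin (y / m) ^ q)
      (q * Real.sin (y / m) ^ q * Real.cos (y / m) / (m * Real.sin (y / m))) y := by
  have h := (hasDerivAt_sin_div m y).rpow_const (p := q) (Or.inl hy.ne')
  rw [Real.rpow_sub_one hy.ne'] at h
  convert h using 1
  ring

/-- The positivity set `{sin(·/m) > 0}` is open, so positivity holds near any of its points.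
[folklore] -/
theorem eventually_sin_div_pos (hy : 0 < Real.sin (y / m)) :
    ∀ᶠ z in 𝓝 y, 0 < Real.sin (z / m) :=
  (Real.continuous_sin.comp (continuous_id.div_const m)).continuousAt.eventually (lt_mem_nhds hy)

/-- The derivative function of `sin(·/m)^q` near a positivity point. [folklore] -/
theorem deriv_sinPow_eventuallyEq (hy : 0 < Real.sin (y / m)) :
    deriv (fun y : ℝ ↦ Real.sin (y / m) ^ q) =ᶠ[𝓝 y]
      fun y ↦ q * Real.sin (y / m) ^ q * Real.cos (y / m) / (m * Real.sin (y / m)) := by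
  filter_upwards [eventually_sin_div_pos hy] with z hz
  exact (hasDerivAt_sinPow hz).deriv

/-- **Second derivative of `sin(y/m)^q`** where `sin(y/m) > 0`:
`q sin(y/m)^q (q cos²(y/m) - 1) / (m² sin²(y/m))`. [folklore] -/
theorem hasDerivAt_deriv_sinPow (hm : m ≠ 0) (hy : 0 < Real.sin (y / m)) :
    HasDerivAt (fun y : ℝ ↦ q * Real.sin (y / m) ^ q * Real.cos (y / m) / (m * Real.sin (y / m)))
      (q * Real.sin (y / m) ^ q * (q * Real.cos (y / m) ^ 2 - 1) / (m ^ 2 * Real.sin (y / m) ^ 2)) y := by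
  have hP := hasDerivAt_sinPow (q := q) hy
  have hc := hasDerivAt_cos_div m y
  have hs := hasDerivAt_sin_div m y
  have hden : m * Real.sin (y / m) ≠ 0 := mul_ne_zero hm hy.ne'
  have h := ((hP.const_mul q).mul hc).div (hs.const_mul m) hden
  have hs0 : Real.sin (y / m) ≠ 0 := hy.ne'
  have hsc : Real.sin (y / m) ^ 2 + Real.cos (y / m) ^ 2 = 1 := Real.sin_sq_add_cos_sq _
  refine h.congr_deriv ?_
  simp only [Pi.mul_apply]
  field_simp
  linear_combination (-q) * hsc

/-- `deriv` of `sin(·/m)^q` at a positivity point. [folklore] -/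
theorem deriv_sinPow (hy : 0 < Real.sin (y / m)) :
    deriv (fun y : ℝ ↦ Real.sin (y / m) ^ q) y =
      q * Real.sin (y / m) ^ q * Real.cos (y / m) / (m * Real.sin (y / m)) :=
  (hasDerivAt_sinPow hy).deriv

/-- `iteratedDeriv 2` of `sin(·/m)^q` at a positivity point. [folklore] -/
theorem iteratedDeriv_two_sinPow (hm : m ≠ 0) (hy : 0 < Real.sin (y / m)) :
    iteratedDeriv 2 (fun y : ℝ ↦ Real.sin (y / m) ^ q) y =
      q * Real.sin (y / m) ^ q * (q * Real.cos (y / m) ^ 2 - 1) / (m ^ 2 * Real.sin (y / m) ^ 2) := by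
  rw [iteratedDeriv_succ, iteratedDeriv_one, (deriv_sinPow_eventuallyEq hy).deriv_eq]
  exact (hasDerivAt_deriv_sinPow hm hy).deriv

/-- `sin(·/m)^q` is `C²` (indeed smooth) on the positivity set of `sin(·/m)`; in particular on
`(0, 2π)` for `m = 2, 4`. [folklore] -/
theorem contDiffOn_sinPow (m : ℝ) {s : Set ℝ} (hs : ∀ y ∈ s, 0 < Real.sin (y / m)) :
    ContDiffOn ℝ 2 (fun y : ℝ ↦ Real.sin (y / m) ^ q) s := by
  intro y hy
  refine (ContDiffAt.rpow_const_of_ne (Real.contDiff_sin.contDiffAt.comp y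
    (contDiffAt_id.div_const m)) (hs y hy).ne').contDiffWithinAt

end SinPow

/-! ### LSW's eigenfunction `H(y) = sin(y/4)^{1 - 4/κ}` and the exponent `(κ² - 16)/(32κ)` -/

/-- **LSW's eigenfunction `H(y) = sin(y/4)^q`**, `q = (κ-4)/κ` (the `θ`-part of the tree's
`lswH κ θ t = sin(θ/4)^q e^{-λt}`, LSW (2002), p. 7): vanishes at `0` (Dirichlet), has zero
derivative at `2π` (Neumann), and `Λ_λ H = 0` (`expGenerator_lswEigen`).
[cite: LawlerSchrammWernerEJP2002, §2 p. 7] -/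
def lswEigen (κ : ℝ≥0) (y : ℝ) : ℝ :=
  Real.sin (y / 4) ^ lswQ (κ : ℝ)

/-- `H(y) = lswH κ y 0`. [folklore] -/
theorem lswEigen_eq_lswH (κ : ℝ≥0) (y : ℝ) :
    lswEigen κ y = Literature.Probability.Percolation.lswH κ y 0 := by
  rw [lswEigen, Literature.Probability.Percolation.lswH, mul_zero, neg_zero, Real.exp_zero, mul_one]

/-- `λ = q (κ + 4)/32`. [folklore] -/
theorem lswLambda_eq {κ : ℝ} (hκ : κ ≠ 0) : lswLambda κ = lswQ κ * (κ + 4) / 32 := by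
  rw [lswLambda, lswQ]
  field_simp
  ring

/-- `κ q = κ - 4`. [folklore] -/
theorem mul_lswQ {κ : ℝ} (hκ : κ ≠ 0) : κ * lswQ κ = κ - 4 := by
  rw [lswQ]; field_simp

/-- `sin(y/2) > 0` on `(0, 2π)`. [folklore] -/
theorem sin_half_pos {y : ℝ} (hy : y ∈ Ioo 0 (2 * Real.pi)) : 0 < Real.sin (y / 2) :=
  Real.sin_pos_of_pos_of_lt_pi (by linarith [hy.1]) (by linarith [hy.2])

/-- `H > 0` on `(0, 2π)`. [folklore] -/
theorem lswEigen_pos (κ : ℝ≥0) {y : ℝ} (hy : y ∈ Ioo 0 (2 * Real.pi)) : 0 < lswEigen κ y :=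
  Real.rpow_pos_of_pos (sin_quarter_pos hy.1 hy.2.le) _

/-- `0 ≤ H` on `[0, 2π]`. [folklore] -/
theorem lswEigen_nonneg (κ : ℝ≥0) {y : ℝ} (hy : y ∈ Icc 0 (2 * Real.pi)) : 0 ≤ lswEigen κ y := by
  have h : 0 ≤ Real.sin (y / 4) :=
    Real.sin_nonneg_of_nonneg_of_le_pi (by linarith [hy.1]) (by linarith [hy.2, Real.pi_pos])
  exact Real.rpow_nonneg h _

/-- `H ≤ 1` on `[0, 2π]` (`κ > 4`). [folklore] -/
theorem lswEigen_le_one {κ : ℝ≥0} (hκ : 4 < κ) {y : ℝ} (hy : y ∈ Icc 0 (2 * Real.pi)) :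
    lswEigen κ y ≤ 1 := by
  have h : 0 ≤ Real.sin (y / 4) :=
    Real.sin_nonneg_of_nonneg_of_le_pi (by linarith [hy.1]) (by linarith [hy.2, Real.pi_pos])
  exact Real.rpow_le_one h (Real.sin_le_one _) (lswQ_pos (by exact_mod_cast hκ)).le

/-- `H(2π) = 1`. [folklore] -/
theorem lswEigen_two_pi (κ : ℝ≥0) : lswEigen κ (2 * Real.pi) = 1 := by
  rw [lswEigen, show 2 * Real.pi / 4 = Real.pi / 2 by ring, Real.sin_pi_div_two, Real.one_rpow]

/-- `H(0) = 0` (`κ > 4`). [folklore] -/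
theorem lswEigen_zero {κ : ℝ≥0} (hκ : 4 < κ) : lswEigen κ 0 = 0 := by
  rw [lswEigen, zero_div, Real.sin_zero, Real.zero_rpow (lswQ_pos (by exact_mod_cast hκ)).ne']

/-- `H` is continuous (`κ > 4`). [folklore] -/
theorem continuous_lswEigen {κ : ℝ≥0} (hκ : 4 < κ) : Continuous (lswEigen κ) :=
  (Real.continuous_sin.comp (continuous_id.div_const _)).rpow_const fun _ ↦
    Or.inr (lswQ_pos (by exact_mod_cast hκ)).le

/-- `H` is `C²` on `(0, 2π)`. [folklore] -/
theorem contDiffOn_lswEigen (κ : ℝ≥0) : ContDiffOn ℝ 2 (lswEigen κ) (Ioo 0 (2 * Real.pi)) :=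
  contDiffOn_sinPow 4 (fun _ hy ↦ sin_quarter_pos hy.1 hy.2.le)

/-- **`Λ_λ H = 0` on `(0, 2π)`**: `(κ/2) H'' + cot(y/2) H' + λ H = 0` for `H(y) = sin(y/4)^q`,
`q = 1 - 4/κ`, `λ = (κ² - 16)/(32κ)` and every `κ > 0` — the computation "Note that `H` also has
all these properties" (`ΛH = 0` for `H(θ,t) = sin(θ/4)^q e^{-λt}`) of LSW (2002), p. 7. With
`u = sin(y/4)`, `c = cos(y/4)`: `H' = q H c/(4u)`, `H'' = q H (q c² - 1)/(16 u²)`,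
`cot(y/2) = (c² - u²)/(2uc)`, and the bracket vanishes because `κ(q - 1) = -4` and
`32 λ = q(κ + 4)`. [cite: LawlerSchrammWernerEJP2002, §2 p. 7] -/
theorem expGenerator_lswEigen {κ : ℝ≥0} (hκ : κ ≠ 0) {y : ℝ} (hy : y ∈ Ioo 0 (2 * Real.pi)) :
    expGenerator κ (lswLambda κ) (lswEigen κ) y = 0 := by
  have hκ' : (κ : ℝ) ≠ 0 := by exact_mod_cast hκ
  have hu := sin_quarter_pos hy.1 hy.2.le
  have hc := cos_quarter_pos hy.1.le hy.2
  set u := Real.sin (y / 4) with hudef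
  set c := Real.cos (y / 4) with hcdef
  set q := lswQ (κ : ℝ) with hqdef
  have hP : lswEigen κ = fun y ↦ Real.sin (y / 4) ^ q := rfl
  have h1 : deriv (lswEigen κ) y = q * u ^ q * c / (4 * u) := by rw [hP, deriv_sinPow hu]
  have h2 : iteratedDeriv 2 (lswEigen κ) y = q * u ^ q * (q * c ^ 2 - 1) / (4 ^ 2 * u ^ 2) := by
    rw [hP, iteratedDeriv_two_sinPow (by norm_num) hu]
  have hsc : u ^ 2 + c ^ 2 = 1 := Real.sin_sq_add_cos_sq _
  have h2u : y / 2 = 2 * (y / 4) := by ring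
  have hsin2 : Real.sin (y / 2) = 2 * u * c := by rw [h2u, Real.sin_two_mul]
  have hcos2 : Real.cos (y / 2) = c ^ 2 - u ^ 2 := by
    rw [h2u, Real.cos_two_mul, ← hcdef]; linear_combination hsc
  have hcot : Real.cot (y / 2) = (c ^ 2 - u ^ 2) / (2 * u * c) := by
    rw [Real.cot_eq_cos_div_sin, hsin2, hcos2]
  have hq : (κ : ℝ) * q = κ - 4 := mul_lswQ hκ'
  have hlam : lswLambda (κ : ℝ) = q * ((κ : ℝ) + 4) / 32 := lswLambda_eq hκ'
  rw [expGenerator_apply, h1, h2, hcot, hlam]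
  have hH : lswEigen κ y = u ^ q := rfl
  rw [hH]
  field_simp
  linear_combination (32 * q * u ^ q * (κ : ℝ)) * hsc + (32 * q * u ^ q * c ^ 2) * hq

/-! ### A positive supersolution with rate above `λ` -/

/-- The exponent `p = 3q/4` of the supersolution. [folklore] -/
def tailP (κ : ℝ≥0) : ℝ :=
  3 * lswQ (κ : ℝ) / 4

/-- The additive constant `c₀ = (q - p)/(1 - q + p)` of the supersolution. [folklore] -/
def tailConst (κ : ℝ≥0) : ℝ :=
  (lswQ (κ : ℝ) - tailP κ) / (1 - lswQ (κ : ℝ) + tailP κ)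

/-- **The rate `μ₀ = (κ p/8)(1 - q + p)`** of the supersolution (`> λ`, `lswLambda_lt_tailRate`).
[folklore] -/
def tailRate (κ : ℝ≥0) : ℝ :=
  (κ : ℝ) * tailP κ / 8 * (1 - lswQ (κ : ℝ) + tailP κ)

/-- **The supersolution `φ(y) = c₀ + sin(y/2)^p`**: positive, bounded, with `Λ_{μ₀} φ ≤ 0` on
`(0, 2π)` (`expGenerator_tailFn_nonpos`). A technical device (no claim of provenance; compare the
Dirichlet eigenfunction `sin(x/2)` of Lawler (2005), Lemma 1.28). [folklore] -/
def tailFn (κ : ℝ≥0) (y : ℝ) : ℝ :=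
  tailConst κ + Real.sin (y / 2) ^ tailP κ

variable {κ : ℝ≥0}

/-- `0 < p`. [folklore] -/
theorem tailP_pos (hκ : 4 < κ) : 0 < tailP κ := by
  rw [tailP]; linarith [lswQ_pos (by exact_mod_cast hκ : (4 : ℝ) < κ)]

/-- `p < q`. [folklore] -/
theorem tailP_lt_lswQ (hκ : 4 < κ) : tailP κ < lswQ (κ : ℝ) := by
  rw [tailP]; linarith [lswQ_pos (by exact_mod_cast hκ : (4 : ℝ) < κ)]

/-- `0 < 1 - q + p`. [folklore] -/
theorem tail_denom_pos (hκ : 4 < κ) : 0 < 1 - lswQ (κ : ℝ) + tailP κ := by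
  linarith [lswQ_lt_one (by exact_mod_cast hκ : (4 : ℝ) < κ), tailP_pos hκ]

/-- `0 < c₀`. [folklore] -/
theorem tailConst_pos (hκ : 4 < κ) : 0 < tailConst κ :=
  div_pos (sub_pos.2 (tailP_lt_lswQ hκ)) (tail_denom_pos hκ)

/-- `0 < μ₀`. [folklore] -/
theorem tailRate_pos (hκ : 4 < κ) : 0 < tailRate κ := by
  have hκ' : (0 : ℝ) < κ := by
    have : (4 : ℝ) < κ := by exact_mod_cast hκ
    linarith
  rw [tailRate]
  exact mul_pos (by have := tailP_pos hκ; positivity) (tail_denom_pos hκ)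

/-- **`λ < μ₀`**: the supersolution's rate beats LSW's exponent (`3κ(4 - q) > 4(κ + 4)` reduces,
using `κ q = κ - 4`, to `5κ > 4`). [folklore] -/
theorem lswLambda_lt_tailRate (hκ : 4 < κ) : lswLambda (κ : ℝ) < tailRate κ := by
  have hκ' : (4 : ℝ) < κ := by exact_mod_cast hκ
  have hκ0 : (κ : ℝ) ≠ 0 := by positivity
  have hq : (κ : ℝ) * lswQ (κ : ℝ) = κ - 4 := mul_lswQ hκ0
  have hqpos := lswQ_pos hκ'
  rw [lswLambda_eq hκ0, tailRate, tailP]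
  -- `q (κ+4)/32 < (3κq/32)(1 - q/4)` iff `4(κ+4) < 3κ(4 - q)` iff `5κ > 4`
  have key : lswQ (κ : ℝ) * ((κ : ℝ) + 4) / 32 -
      (κ : ℝ) * (3 * lswQ (κ : ℝ) / 4) / 8 * (1 - lswQ (κ : ℝ) + 3 * lswQ (κ : ℝ) / 4)
      = lswQ (κ : ℝ) / 128 * (4 - 5 * κ) := by
    linear_combination ((3 : ℝ) / 128 * lswQ (κ : ℝ)) * hq
  have : lswQ (κ : ℝ) / 128 * (4 - 5 * (κ : ℝ)) < 0 :=
    mul_neg_of_pos_of_neg (by positivity) (by linarith)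
  linarith

/-- `c₀ ≤ φ`. [folklore] -/
theorem tailConst_le_tailFn (κ : ℝ≥0) {y : ℝ} (hy : y ∈ Icc 0 (2 * Real.pi)) :
    tailConst κ ≤ tailFn κ y := by
  have h : 0 ≤ Real.sin (y / 2) :=
    Real.sin_nonneg_of_nonneg_of_le_pi (by linarith [hy.1]) (by linarith [hy.2])
  have := Real.rpow_nonneg h (tailP κ)
  rw [tailFn]; linarith

/-- `φ ≤ c₀ + 1` (`κ > 4`). [folklore] -/
theorem tailFn_le (hκ : 4 < κ) {y : ℝ} (hy : y ∈ Icc 0 (2 * Real.pi)) :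
    tailFn κ y ≤ tailConst κ + 1 := by
  have h : 0 ≤ Real.sin (y / 2) :=
    Real.sin_nonneg_of_nonneg_of_le_pi (by linarith [hy.1]) (by linarith [hy.2])
  have := Real.rpow_le_one h (Real.sin_le_one _) (tailP_pos hκ).le
  rw [tailFn]; linarith

/-- `φ` is `C²` on `(0, 2π)`. [folklore] -/
theorem contDiffOn_tailFn (κ : ℝ≥0) : ContDiffOn ℝ 2 (tailFn κ) (Ioo 0 (2 * Real.pi)) :=
  contDiffOn_const.add (contDiffOn_sinPow 2 (fun _ hy ↦ sin_half_pos hy))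

/-- **`Λ_{μ₀} φ ≤ 0` on `(0, 2π)`** for `κ > 4`: with `v = sin(y/2)`,
`Λ_{μ₀} φ (y) = (κ p (q - p)/8) (1 - v^{p-2}) ≤ 0` since `0 < v ≤ 1` and `p < 2`. [folklore] -/
theorem expGenerator_tailFn_nonpos (hκ : 4 < κ) {y : ℝ} (hy : y ∈ Ioo 0 (2 * Real.pi)) :
    expGenerator κ (tailRate κ) (tailFn κ) y ≤ 0 := by
  have hκ' : (4 : ℝ) < κ := by exact_mod_cast hκ
  have hκ0 : (κ : ℝ) ≠ 0 := by positivity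
  have hv := sin_half_pos hy
  set v := Real.sin (y / 2) with hvdef
  set w := Real.cos (y / 2) with hwdef
  set p := tailP κ with hpdef
  set q := lswQ (κ : ℝ) with hqdef
  have hq : (κ : ℝ) * q = κ - 4 := mul_lswQ hκ0
  have hp : p = 3 * q / 4 := rfl
  -- derivatives of `φ = c₀ + v^p`
  have hφ : tailFn κ = fun y ↦ tailConst κ + Real.sin (y / 2) ^ p := rfl
  have hd1 : deriv (tailFn κ) y = p * v ^ p * w / (2 * v) := by
    rw [hφ, deriv_const_add, deriv_sinPow hv]
  have hd2 : iteratedDeriv 2 (tailFn κ) y = p * v ^ p * (p * w ^ 2 - 1) / (2 ^ 2 * v ^ 2) := by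
    have : deriv (tailFn κ) = deriv fun y ↦ Real.sin (y / 2) ^ p := by
      rw [hφ]; exact deriv_const_add' _
    rw [iteratedDeriv_succ, iteratedDeriv_one, this,
      (deriv_sinPow_eventuallyEq (m := 2) (q := p) hv).deriv_eq]
    exact (hasDerivAt_deriv_sinPow (by norm_num) hv).deriv
  have hcot : Real.cot (y / 2) = w / v := Real.cot_eq_cos_div_sin _
  have hsc : v ^ 2 + w ^ 2 = 1 := Real.sin_sq_add_cos_sq _
  have hval : expGenerator κ (tailRate κ) (tailFn κ) y =
      (κ : ℝ) * p * (q - p) / 8 * (1 - v ^ p / v ^ 2) := by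
    rw [expGenerator_apply, hd1, hd2, hcot, tailRate, ← hpdef, ← hqdef]
    have hφy : tailFn κ y = tailConst κ + v ^ p := rfl
    rw [hφy, tailConst, ← hpdef, ← hqdef]
    have hden : 1 - q + p ≠ 0 := (tail_denom_pos hκ).ne'
    field_simp
    linear_combination (8 * p * v ^ p * (4 + p * (κ : ℝ))) * hsc + (8 * p * v ^ p * (1 - v ^ 2)) * hq
  rw [hval]
  have hcoef : 0 ≤ (κ : ℝ) * p * (q - p) / 8 := by
    have := tailP_pos hκ; have := tailP_lt_lswQ hκ
    have : 0 ≤ q - p := by rw [hqdef, hpdef]; linarith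
    positivity
  refine mul_nonpos_of_nonneg_of_nonpos hcoef (sub_nonpos.2 ?_)
  -- `v^p / v^2 = v^{p-2} ≥ 1`
  rw [le_div_iff₀ (by positivity), one_mul, ← Real.rpow_two]
  exact Real.rpow_le_rpow_of_exponent_ge hv (Real.sin_le_one _) (by
    rw [hpdef, tailP]; linarith [lswQ_lt_one hκ'])

end RadialLoewner

end Literature.Probability.RandomPlanarGeometry
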